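import Summits.CriticalPhenomena.Ising3D.TaylorTableOddHeadParts2Cell
import HarnessLib

/-!
# XXXIf: the `Scal2` enclosure checks (`Scal2OK`, `scal2Check`, `scal2Check2` and their soundness)
(cell `pub-ising3x`, seat boot-1 gen 15/16; the MERGED-2 (first-order) odd-head test chain, landed per LEAN-PLAN-MERGED2 in ten modules)

HONEST FRAMING: lottery ticket; floor = tightest certified 3D Ising CFT bounds; no exact-solution
claim without a proof. Island framing: certified exclusion region at stated derivative order and
assumptions; not a determination of the 3D Ising critical exponents beyond that.

[folklore]
-/

namespace Summit.CriticalPhenomena.Ising3D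

open Finset Set
open Literature.Analysis.ValidatedNumerics Literature.Analysis.ValidatedNumerics.PolyMP
open Literature.Analysis.ValidatedNumerics.NumericsMP
open Literature.MathematicalPhysics.QuantumFieldTheory.ConformalBootstrap3D
open Literature.MathematicalPhysics.QuantumFieldTheory.ConformalBootstrap3D.HRTM
open Literature.MathematicalPhysics.QuantumFieldTheory.ConformalBootstrap3D.PointKernel (mulQ mem_mulQ legendreLamQ)

namespace HeadParts2


/-- Interval containment `I ⊆ J`. [folklore] -/
def subMI (I J : MI) : Bool := decide (J.lo ≤ I.lo) && decide (I.hi ≤ J.hi)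

/-- [folklore] -/
theorem mem_of_subMI {S : ℕ} {x : ℝ} {I J : MI} (h : subMI I J = true) (hx : MI.mem S x I) : MI.mem S x J := by
  simp only [subMI, Bool.and_eq_true, decide_eq_true_eq] at h
  obtain ⟨h1, h2⟩ := hx
  exact ⟨le_trans (by exact_mod_cast h.1) h1, le_trans h2 (by exact_mod_cast h.2)⟩

/-- Rational lower bound of `ln 2` (Mathlib `Real.log_two_gt_d9`). [folklore] -/
def LN2lo : ℚ := 6931471803 / 10000000000
/-- Rational upper bound of `ln 2` (Mathlib `Real.log_two_lt_d9`). [folklore] -/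
def LN2hi : ℚ := 6931471808 / 10000000000

/-- [folklore] -/
theorem ln2_bounds : ((LN2lo : ℚ) : ℝ) ≤ Real.log 2 ∧ Real.log 2 ≤ ((LN2hi : ℚ) : ℝ) := by
  have h1 := Real.log_two_gt_d9
  have h2 := Real.log_two_lt_d9
  unfold LN2lo LN2hi
  constructor
  · exact le_of_lt (by push_cast; linarith)
  · exact le_of_lt (by push_cast; linarith)

/-- Point power enclosures of the three centre scalars. [folklore] -/
structure Scal2Cert where
  /-- `(½)^{ε₀−σ₀}` -/
  Kc : PowEncl
  /-- `(½)^{−2σ₀}` -/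
  Mσc : PowEncl
  /-- `(½)^{−2ε₀}` -/
  Mεc : PowEncl

/-- **The `Scal2` enclosure check**: the kernel's centre-scalar intervals contain certified enclosures of the true centre scalars and their
`ln 2`-multiples, and `2·max(Wσ,Wε)·ln2⁺ ≤ U ≤ 1`. [folklore] -/
def scal2Check (S : ℕ) (σ0 ε0 Wσ Wε κ₀ : ℚ) (E : Scal2Cert) (sc : Scal2) : Bool :=
  E.Kc.check (ε0 - σ0) (ε0 - σ0) && E.Mσc.check (-(2 * σ0)) (-(2 * σ0)) && E.Mεc.check (-(2 * ε0)) (-(2 * ε0)) &&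
  decide (0 ≤ E.Kc.lo) && decide (0 ≤ E.Mσc.lo) && decide (0 ≤ E.Mεc.lo) && decide (0 < κ₀) &&
  subMI (HRTMAB.ivlQ S E.Kc.lo E.Kc.hi) sc.K &&
  subMI (HRTMAB.ivlQ S (LN2lo * E.Kc.lo) (LN2hi * E.Kc.hi)) sc.dK &&
  subMI (HRTMAB.ivlQ S (E.Mσc.lo * (κ₀⁻¹ / 2)) (E.Mσc.hi * (κ₀⁻¹ / 2))) sc.C0 &&
  subMI (HRTMAB.ivlQ S (2 * LN2lo * (E.Mσc.lo * (κ₀⁻¹ / 2))) (2 * LN2hi * (E.Mσc.hi * (κ₀⁻¹ / 2)))) sc.dC0x &&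
  subMI (HRTMAB.ivlQ S (E.Mεc.hi * (-(κ₀⁻¹ / 2))) (E.Mεc.lo * (-(κ₀⁻¹ / 2)))) sc.Ct &&
  subMI (HRTMAB.ivlQ S (2 * LN2hi * (E.Mεc.hi * (-(κ₀⁻¹ / 2)))) (2 * LN2lo * (E.Mεc.lo * (-(κ₀⁻¹ / 2))))) sc.dCty &&
  decide (0 ≤ max Wσ Wε) && decide (2 * max Wσ Wε * LN2hi ≤ sc.U) && decide (sc.U ≤ 1)

/-- A point power check gives `lo ≤ (½)^t ≤ hi` at the point. [folklore] -/
theorem powEncl_point {P : PowEncl} {t : ℚ} (h : P.check t t = true) :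
    (P.lo : ℝ) ≤ (1 / 2 : ℝ) ^ (t : ℝ) ∧ (1 / 2 : ℝ) ^ (t : ℝ) ≤ (P.hi : ℝ) := by
  obtain ⟨hhi, hr₁, hr₂, h₁, h₂⟩ := TaylorTable.PowEncl.check_spec h
  exact half_rpow_mem_of_checks hhi h₁ h₂ (by exact_mod_cast hr₁) (by exact_mod_cast hr₂)

/-- The eight centre-scalar facts the cell theorem consumes. [folklore] -/
def Scal2OK (S : ℕ) (σ0 ε0 Wσ Wε κ₀ : ℚ) (sc : Scal2) : Prop :=
    MI.mem S ((1 / 2 : ℝ) ^ ((ε0 : ℝ) - σ0)) sc.K ∧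
    MI.mem S (Real.log 2 * (1 / 2 : ℝ) ^ ((ε0 : ℝ) - σ0)) sc.dK ∧
    MI.mem S ((1 / 2 : ℝ) ^ (-(2 * (σ0 : ℝ))) * ((κ₀⁻¹ / 2 : ℚ) : ℝ)) sc.C0 ∧
    MI.mem S (2 * Real.log 2 * ((1 / 2 : ℝ) ^ (-(2 * (σ0 : ℝ))) * ((κ₀⁻¹ / 2 : ℚ) : ℝ))) sc.dC0x ∧
    MI.mem S ((1 / 2 : ℝ) ^ (-(2 * (ε0 : ℝ))) * ((-(κ₀⁻¹ / 2) : ℚ) : ℝ)) sc.Ct ∧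
    MI.mem S (2 * Real.log 2 * ((1 / 2 : ℝ) ^ (-(2 * (ε0 : ℝ))) * ((-(κ₀⁻¹ / 2) : ℚ) : ℝ))) sc.dCty ∧
    2 * max (Wσ : ℝ) Wε * Real.log 2 ≤ sc.U ∧ (sc.U : ℝ) ≤ 1

/-- **Soundness of the `Scal2` check** (coarse `ln 2` version): the centre-scalar hypotheses of `oddHead_nonneg_of_parts2`. [folklore] -/
theorem scal2Check_sound {S : ℕ} {σ0 ε0 Wσ Wε κ₀ : ℚ} {E : Scal2Cert} {sc : Scal2}
    (h : scal2Check S σ0 ε0 Wσ Wε κ₀ E sc = true) : Scal2OK S σ0 ε0 Wσ Wε κ₀ sc := by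
  unfold Scal2OK
  simp only [scal2Check, Bool.and_eq_true, decide_eq_true_eq] at h
  obtain ⟨⟨⟨⟨⟨⟨⟨⟨⟨⟨⟨⟨⟨⟨⟨hK, hMσ⟩, hMε⟩, hK0⟩, hMσ0⟩, hMε0⟩, hκ⟩, sK⟩, sdK⟩, sC0⟩, sdC0⟩, sCt⟩, sdCt⟩, hmax⟩, hU⟩, hU1⟩ := h
  obtain ⟨l1, l2⟩ := ln2_bounds
  have hln0 : 0 ≤ Real.log 2 := le_trans (by unfold LN2lo; push_cast; norm_num) l1
  obtain ⟨k1, k2⟩ := powEncl_point hK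
  obtain ⟨m1, m2⟩ := powEncl_point hMσ
  obtain ⟨n1, n2⟩ := powEncl_point hMε
  have eK : ((ε0 - σ0 : ℚ) : ℝ) = (ε0 : ℝ) - σ0 := by push_cast; ring
  have eMσ : ((-(2 * σ0) : ℚ) : ℝ) = -(2 * (σ0 : ℝ)) := by push_cast; ring
  have eMε : ((-(2 * ε0) : ℚ) : ℝ) = -(2 * (ε0 : ℝ)) := by push_cast; ring
  rw [eK] at k1 k2
  rw [eMσ] at m1 m2
  rw [eMε] at n1 n2
  set vK : ℝ := (1 / 2 : ℝ) ^ ((ε0 : ℝ) - σ0)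
  set vσ : ℝ := (1 / 2 : ℝ) ^ (-(2 * (σ0 : ℝ)))
  set vε : ℝ := (1 / 2 : ℝ) ^ (-(2 * (ε0 : ℝ)))
  have hK0' : (0 : ℝ) ≤ E.Kc.lo := by exact_mod_cast hK0
  have hMσ0' : (0 : ℝ) ≤ E.Mσc.lo := by exact_mod_cast hMσ0
  have hMε0' : (0 : ℝ) ≤ E.Mεc.lo := by exact_mod_cast hMε0
  have hk : (0 : ℝ) < (κ₀ : ℝ)⁻¹ / 2 := by
    have : (0 : ℝ) < (κ₀ : ℝ) := by exact_mod_cast hκ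
    positivity
  have hmax' : (0 : ℝ) ≤ max (Wσ : ℝ) Wε := by
    have : ((max Wσ Wε : ℚ) : ℝ) = max (Wσ : ℝ) Wε := by push_cast; rfl
    rw [← this]; exact_mod_cast hmax
  have hσhi0 : (0 : ℝ) ≤ E.Mσc.hi := le_trans hMσ0' (le_trans m1 m2)
  have hεhi0 : (0 : ℝ) ≤ E.Mεc.hi := le_trans hMε0' (le_trans n1 n2)
  -- product hints (all nonnegative)
  have p1 : 0 ≤ (Real.log 2 - LN2lo) * (E.Kc.lo : ℝ) := mul_nonneg (sub_nonneg.mpr l1) hK0'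
  have p2 : 0 ≤ Real.log 2 * (vK - E.Kc.lo) := mul_nonneg hln0 (sub_nonneg.mpr k1)
  have p3 : 0 ≤ ((LN2hi : ℝ) - Real.log 2) * (E.Kc.hi : ℝ) := mul_nonneg (sub_nonneg.mpr l2) (le_trans hK0' (le_trans k1 k2))
  have p4 : 0 ≤ Real.log 2 * ((E.Kc.hi : ℝ) - vK) := mul_nonneg hln0 (sub_nonneg.mpr k2)
  have q1 : 0 ≤ (vσ - E.Mσc.lo) * ((κ₀ : ℝ)⁻¹ / 2) := mul_nonneg (sub_nonneg.mpr m1) hk.le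
  have q2 : 0 ≤ ((E.Mσc.hi : ℝ) - vσ) * ((κ₀ : ℝ)⁻¹ / 2) := mul_nonneg (sub_nonneg.mpr m2) hk.le
  have q3 : 0 ≤ (Real.log 2 - LN2lo) * (E.Mσc.lo : ℝ) * ((κ₀ : ℝ)⁻¹ / 2) := mul_nonneg (mul_nonneg (sub_nonneg.mpr l1) hMσ0') hk.le
  have q4 : 0 ≤ Real.log 2 * (vσ - E.Mσc.lo) * ((κ₀ : ℝ)⁻¹ / 2) := mul_nonneg (mul_nonneg hln0 (sub_nonneg.mpr m1)) hk.le
  have q5 : 0 ≤ ((LN2hi : ℝ) - Real.log 2) * (E.Mσc.hi : ℝ) * ((κ₀ : ℝ)⁻¹ / 2) := mul_nonneg (mul_nonneg (sub_nonneg.mpr l2) hσhi0) hk.le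
  have q6 : 0 ≤ Real.log 2 * ((E.Mσc.hi : ℝ) - vσ) * ((κ₀ : ℝ)⁻¹ / 2) := mul_nonneg (mul_nonneg hln0 (sub_nonneg.mpr m2)) hk.le
  have r1 : 0 ≤ (vε - E.Mεc.lo) * ((κ₀ : ℝ)⁻¹ / 2) := mul_nonneg (sub_nonneg.mpr n1) hk.le
  have r2 : 0 ≤ ((E.Mεc.hi : ℝ) - vε) * ((κ₀ : ℝ)⁻¹ / 2) := mul_nonneg (sub_nonneg.mpr n2) hk.le
  have r3 : 0 ≤ (Real.log 2 - LN2lo) * (E.Mεc.lo : ℝ) * ((κ₀ : ℝ)⁻¹ / 2) := mul_nonneg (mul_nonneg (sub_nonneg.mpr l1) hMε0') hk.le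
  have r4 : 0 ≤ Real.log 2 * (vε - E.Mεc.lo) * ((κ₀ : ℝ)⁻¹ / 2) := mul_nonneg (mul_nonneg hln0 (sub_nonneg.mpr n1)) hk.le
  have r5 : 0 ≤ ((LN2hi : ℝ) - Real.log 2) * (E.Mεc.hi : ℝ) * ((κ₀ : ℝ)⁻¹ / 2) := mul_nonneg (mul_nonneg (sub_nonneg.mpr l2) hεhi0) hk.le
  have r6 : 0 ≤ Real.log 2 * ((E.Mεc.hi : ℝ) - vε) * ((κ₀ : ℝ)⁻¹ / 2) := mul_nonneg (mul_nonneg hln0 (sub_nonneg.mpr n2)) hk.le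
  have u1 : 0 ≤ ((LN2hi : ℝ) - Real.log 2) * max (Wσ : ℝ) Wε := mul_nonneg (sub_nonneg.mpr l2) hmax'
  refine ⟨mem_of_subMI sK (HRTMAB.mem_ivlQ S k1 k2), mem_of_subMI sdK (HRTMAB.mem_ivlQ S ?_ ?_),
    mem_of_subMI sC0 (HRTMAB.mem_ivlQ S ?_ ?_), mem_of_subMI sdC0 (HRTMAB.mem_ivlQ S ?_ ?_),
    mem_of_subMI sCt (HRTMAB.mem_ivlQ S ?_ ?_), mem_of_subMI sdCt (HRTMAB.mem_ivlQ S ?_ ?_), ?_, by exact_mod_cast hU1⟩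
  · push_cast; linarith [p1, p2]
  · push_cast; linarith [p3, p4]
  · push_cast; linarith [q1]
  · push_cast; linarith [q2]
  · push_cast; linarith [q3, q4]
  · push_cast; linarith [q5, q6]
  · push_cast; linarith [r2]
  · push_cast; linarith [r1]
  · push_cast; linarith [r5, r6]
  · push_cast; linarith [r3, r4]
  · have hU' : ((2 * max Wσ Wε * LN2hi : ℚ) : ℝ) ≤ (sc.U : ℝ) := by exact_mod_cast hU
    have e : ((2 * max Wσ Wε * LN2hi : ℚ) : ℝ) = 2 * max (Wσ : ℝ) Wε * ((LN2hi : ℚ) : ℝ) := by push_cast; rfl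
    rw [e] at hU'
    linarith [u1]

/-- **The `Scal2` enclosure check, sharp `ln 2` version**: as `scal2Check` but the `ln 2` multiples use the tree's arbitrary-precision enclosure
`MI.logTwo S Klog` and `MI.mul`, so the kernel's derivative scalars need only a few ulps of slack. [folklore] -/
def scal2Check2 (S Klog : ℕ) (σ0 ε0 Wσ Wε κ₀ : ℚ) (E : Scal2Cert) (sc : Scal2) : Bool :=
  match MI.logTwo S Klog with
  | none => false
  | some L =>
    decide (0 < S) &&
    E.Kc.check (ε0 - σ0) (ε0 - σ0) && E.Mσc.check (-(2 * σ0)) (-(2 * σ0)) && E.Mεc.check (-(2 * ε0)) (-(2 * ε0)) &&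
    decide (0 < κ₀) &&
    subMI (HRTMAB.ivlQ S E.Kc.lo E.Kc.hi) sc.K &&
    subMI (MI.mul S L (HRTMAB.ivlQ S E.Kc.lo E.Kc.hi)) sc.dK &&
    subMI (HRTMAB.ivlQ S (E.Mσc.lo * (κ₀⁻¹ / 2)) (E.Mσc.hi * (κ₀⁻¹ / 2))) sc.C0 &&
    subMI (MI.mul S (MI.mulInt L 2) (HRTMAB.ivlQ S (E.Mσc.lo * (κ₀⁻¹ / 2)) (E.Mσc.hi * (κ₀⁻¹ / 2)))) sc.dC0x &&
    subMI (HRTMAB.ivlQ S (E.Mεc.hi * (-(κ₀⁻¹ / 2))) (E.Mεc.lo * (-(κ₀⁻¹ / 2)))) sc.Ct &&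
    subMI (MI.mul S (MI.mulInt L 2) (HRTMAB.ivlQ S (E.Mεc.hi * (-(κ₀⁻¹ / 2))) (E.Mεc.lo * (-(κ₀⁻¹ / 2))))) sc.dCty &&
    decide (0 ≤ max Wσ Wε) && decide (2 * max Wσ Wε * (L.hi : ℚ) ≤ sc.U * S) && decide (sc.U ≤ 1)

/-- **Soundness of `scal2Check2`.** [folklore] -/
theorem scal2Check2_sound {S Klog : ℕ} {σ0 ε0 Wσ Wε κ₀ : ℚ} {E : Scal2Cert} {sc : Scal2}
    (h : scal2Check2 S Klog σ0 ε0 Wσ Wε κ₀ E sc = true) : Scal2OK S σ0 ε0 Wσ Wε κ₀ sc := by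
  unfold Scal2OK
  unfold scal2Check2 at h
  split at h
  · exact absurd h (by simp)
  · rename_i L hL
    simp only [Bool.and_eq_true, decide_eq_true_eq] at h
    obtain ⟨⟨⟨⟨⟨⟨⟨⟨⟨⟨⟨⟨⟨hS, hK⟩, hMσ⟩, hMε⟩, hκ⟩, sK⟩, sdK⟩, sC0⟩, sdC0⟩, sCt⟩, sdCt⟩, hmax⟩, hU⟩, hU1⟩ := h
    have hlog : MI.mem S (Real.log 2) L := MI.mem_logTwo hS hL
    have hlog2 : MI.mem S (Real.log 2 * ((2 : ℤ) : ℝ)) (MI.mulInt L 2) := MI.mem_mulInt hlog 2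
    obtain ⟨k1, k2⟩ := powEncl_point hK
    obtain ⟨m1, m2⟩ := powEncl_point hMσ
    obtain ⟨n1, n2⟩ := powEncl_point hMε
    have eK : ((ε0 - σ0 : ℚ) : ℝ) = (ε0 : ℝ) - σ0 := by push_cast; ring
    have eMσ : ((-(2 * σ0) : ℚ) : ℝ) = -(2 * (σ0 : ℝ)) := by push_cast; ring
    have eMε : ((-(2 * ε0) : ℚ) : ℝ) = -(2 * (ε0 : ℝ)) := by push_cast; ring
    rw [eK] at k1 k2
    rw [eMσ] at m1 m2
    rw [eMε] at n1 n2
    have hk : (0 : ℝ) < (κ₀ : ℝ)⁻¹ / 2 := by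
      have : (0 : ℝ) < (κ₀ : ℝ) := by exact_mod_cast hκ
      positivity
    have q1 : 0 ≤ ((1 / 2 : ℝ) ^ (-(2 * (σ0 : ℝ))) - E.Mσc.lo) * ((κ₀ : ℝ)⁻¹ / 2) := mul_nonneg (sub_nonneg.mpr m1) hk.le
    have q2 : 0 ≤ ((E.Mσc.hi : ℝ) - (1 / 2 : ℝ) ^ (-(2 * (σ0 : ℝ)))) * ((κ₀ : ℝ)⁻¹ / 2) := mul_nonneg (sub_nonneg.mpr m2) hk.le
    have r1 : 0 ≤ ((1 / 2 : ℝ) ^ (-(2 * (ε0 : ℝ))) - E.Mεc.lo) * ((κ₀ : ℝ)⁻¹ / 2) := mul_nonneg (sub_nonneg.mpr n1) hk.le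
    have r2 : 0 ≤ ((E.Mεc.hi : ℝ) - (1 / 2 : ℝ) ^ (-(2 * (ε0 : ℝ)))) * ((κ₀ : ℝ)⁻¹ / 2) := mul_nonneg (sub_nonneg.mpr n2) hk.le
    have hKc : MI.mem S ((1 / 2 : ℝ) ^ ((ε0 : ℝ) - σ0)) (HRTMAB.ivlQ S E.Kc.lo E.Kc.hi) := HRTMAB.mem_ivlQ S k1 k2
    have hC0 : MI.mem S ((1 / 2 : ℝ) ^ (-(2 * (σ0 : ℝ))) * ((κ₀⁻¹ / 2 : ℚ) : ℝ))
        (HRTMAB.ivlQ S (E.Mσc.lo * (κ₀⁻¹ / 2)) (E.Mσc.hi * (κ₀⁻¹ / 2))) :=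
      HRTMAB.mem_ivlQ S (by push_cast; linarith [q1]) (by push_cast; linarith [q2])
    have hCt : MI.mem S ((1 / 2 : ℝ) ^ (-(2 * (ε0 : ℝ))) * ((-(κ₀⁻¹ / 2) : ℚ) : ℝ))
        (HRTMAB.ivlQ S (E.Mεc.hi * (-(κ₀⁻¹ / 2))) (E.Mεc.lo * (-(κ₀⁻¹ / 2)))) :=
      HRTMAB.mem_ivlQ S (by push_cast; linarith [r2]) (by push_cast; linarith [r1])
    have hdK := MI.mem_mul hS hlog hKc
    have hdC0 := MI.mem_mul hS hlog2 hC0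
    have hdCt := MI.mem_mul hS hlog2 hCt
    have e2 : Real.log 2 * ((2 : ℤ) : ℝ) = 2 * Real.log 2 := by push_cast; ring
    rw [e2] at hdC0 hdCt
    -- U
    have hmax' : (0 : ℝ) ≤ max (Wσ : ℝ) Wε := by
      have : ((max Wσ Wε : ℚ) : ℝ) = max (Wσ : ℝ) Wε := by push_cast; rfl
      rw [← this]; exact_mod_cast hmax
    have hSr : (0 : ℝ) < (S : ℝ) := by exact_mod_cast hS
    have hLhi : Real.log 2 * S ≤ (L.hi : ℝ) := hlog.2
    have hU' : ((2 * max Wσ Wε * (L.hi : ℚ) : ℚ) : ℝ) ≤ ((sc.U * S : ℚ) : ℝ) := by exact_mod_cast hU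
    have eU : ((2 * max Wσ Wε * (L.hi : ℚ) : ℚ) : ℝ) = 2 * max (Wσ : ℝ) Wε * (L.hi : ℝ) := by push_cast; rfl
    have eU2 : ((sc.U * S : ℚ) : ℝ) = (sc.U : ℝ) * S := by push_cast; rfl
    rw [eU, eU2] at hU'
    have u1 : 0 ≤ max (Wσ : ℝ) Wε * ((L.hi : ℝ) - Real.log 2 * S) := mul_nonneg hmax' (sub_nonneg.mpr hLhi)
    refine ⟨mem_of_subMI sK hKc, mem_of_subMI sdK hdK, mem_of_subMI sC0 hC0, mem_of_subMI sdC0 hdC0,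
      mem_of_subMI sCt hCt, mem_of_subMI sdCt hdCt, ?_, by exact_mod_cast hU1⟩
    -- 2·max·log2·S ≤ 2·max·L.hi ≤ U·S, divide by S
    have : 2 * max (Wσ : ℝ) Wε * Real.log 2 * S ≤ (sc.U : ℝ) * S := by nlinarith [u1, hU']
    exact le_of_mul_le_mul_right this hSr

end HeadParts2

end Summit.CriticalPhenomena.Ising3D
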